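import Summits.HodgeConjecture.HodgeConjecture.Theorems.Ring2AbelianAllAndreDiscriminantTransport
import Summits.HodgeConjecture.HodgeConjecture.Theorems.Ring2HypothesesWeilComponentsCMRosati
import Literature.AlgebraicGeometry.Andre1996.CompactPencilReduction
import HarnessLib

/-!
# Ring 2 · AbelianAll — ANDRÉ AXIS, PART S-e: THE `δ`-COMPONENT IS CONSTANT ALONG A COMPACT PENCIL WITH A GLOBAL `E`-ACTION — Deligne's
  discriminant `disc φ ∈ E⁺ˣ/N(Eˣ)` of the hermitian form of a RELATIVE polarization class (`HasWeilDiscriminantCM`) and the Rosati condition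
  «the Rosati involution induces complex conjugation on `E`» (`RosatiCompatible`) are the same at every member (the CM-field form of part L-a;
  owed item (o157), discriminant half; fact-free)

HONEST FRAMING (page 1, verbatim): **research route, not a corollary; conditional on HC_CM plus one named minimal statement.** Cell line:
research route conditional on HC_CM; not a corollary; Q11.4-sentence-2 already refuted in dim ≥ 3. Nothing in this file proves a case of the
Hodge conjecture or of `B(X)` for a named `X`; `HC_CM`, `HC_AV`, the global nodes and Verdier's binder do NOT occur. Item
`Theses.RankFourFaces.CMToAbelian` (stmt-16267) stays OPEN; N104 untouched; no node is born (0 `def`, 0 `sorry`, no named fact). Seat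
`pub-hodge-ring2-ab-andre-2`, gen 49 (part S). Part L-a (gen 42, `…AndreDiscriminantTransport`) proved the imaginary-quadratic case: van Geemen's
`det H ∈ ℚˣ/Nm(K_dˣ)` (`HasWeilDiscriminantNondeg`) of `(A_s, φ_s, e_s^*(H|X_s))` is the same at every member of a compact abelian pencil with a
global `K`-action and a global class `H`. Here `E = ℚ[T]/(R(T²))` is a CM field of any degree and the invariant is Deligne's `disc φ ∈ E⁺ˣ/N(Eˣ)` on
the carriers (`Deligne1982.HasWeilDiscriminantCM A η R e₀ k h δ`: an `E`-basis `x_b` of `H¹(A, ℚ)`, a rational top class `ω`, rational pairing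
data `c_{abj}` with `Q_h((η^*)ʲ x_a, x_b) = c_{abj} ω`, a Gram matrix `Φ ∈ M_{2k}(E)` with `Tr(tʲ Φ_{ab}) = c_{abj}`, `q = t^{2k} det Φ ∈ E⁺ˣ` of class
`δ`), together with the Rosati condition `Q_h(η^* x, y) = -Q_h(x, η^* y)` (`Ring2.Hypotheses.RosatiCompatible`) — the member hypotheses of the
cell's δ-indexed targets `WeilClassesComponentCM R e₀ k δ` and of part S-b's anchors. With this file they are read at ONE member of the pencil.

## Content (theorems only; standard axioms)

* §1 (AV level) **`hasWeilDiscriminantCM_of_transport`** — for abelian varieties `A`, `B` of the same dimension `d_A`, injective `ℂ`-linear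
  `T₁ : H¹(A) → H¹(B)`, `T₂ : H^{2+2(d_A-1)}(A) → H^{2+2(d_A-1)}(B)` carrying rational classes to rational classes, with `T₁ ∘ η^* = ψ^* ∘ T₁` and
  `T₂ (Q_{h, d_A-1}(x, y)) = Q_{h', d_A-1}(T₁ x, T₁ y)`: a discriminant witness of class `δ` for `(A, η, h)` is carried to one for `(B, ψ, h')` —
  the `E`-basis `x_b ↦ T₁ x_b` (its `E`-translates stay independent: `T₁ ∘ (η^*)ʲ = (ψ^*)ʲ ∘ T₁`), `ω ↦ T₂ ω`, and the SAME data `c, Φ, q`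
  (Deligne: `disc φ` only sees the `E`-hermitian lattice). **`rosatiCompatible_of_transport`** — with `T₁` moreover surjective, the Rosati
  condition passes from `(A, η, h)` to `(B, ψ, h')`.
* §2 (pencils) **`hasWeilDiscriminantCM_of_transportFun`**, **`rosatiCompatible_of_transportFun`** — along a homotopy class of paths in a
  homotopically locally trivial family with an endomorphism `Φ` OVER the base and a global class `H ∈ H²(𝒳(ℂ); ℂ)`, through `Φ`-compatible charts
  `e_A : A ≅ X_s`, `e_B : B ≅ X_t`: §1 applied to `T = e_B^* ∘ γ_* ∘ (e_A⁻¹)^*` (injective/surjective: transport is invertible; rational: the tree's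
  `isRationalClass_transportFun`; `Φ`-equivariant: `transportFun_map_fiberHom`; `Q_H`-compatible: part L-a's `transportFun_polarizationPairingOne`).
  **`hasWeilDiscriminantCM_of_fibreTransport`**, **`rosatiCompatible_of_fibreTransport`** — any two complex points of a connected smooth proper
  family over a smooth compact base (Ehresmann on complex points). **`hasWeilDiscriminantCM_member_iff`**, **`rosatiCompatible_member_iff`** —
  THE ROWS: on a compact abelian pencil `f : 𝒳 ⟶ S` (`IsCompactAbelianPencil f d`) with a global endomorphism `Φ` over `S`, a global class `H`
  and `Φ`-compatible charts `(A_s, e_s, φ_s)`, for any two members `s`, `t`: `(A_s, φ_s, e_s^*(H|X_s))` has a discriminant witness of class `δ`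
  (resp. is Rosati-compatible) iff `(A_t, φ_t, e_t^*(H|X_t))` has one (resp. is).

## Honest status

Fact-free hypothesis transport: with part R-c (Weil type relative to `E` constant along the pencil) and this file, EVERY member of a compact
`E`-pencil through ring2-b03's δ-anchor `(A₀, η₀, h₀)` (part S-b), polarized by a global class restricting to `h₀` on the anchor chart, lies on the
SAME δ-component `(R, e₀, k, δ)` of the cell's typed target `WeilClassesComponentCM` — so part S-b's rows are rows FOR the δ-component pencils.
Positivity (`IsPolarizationClass` / Kähler) of the restricted class is NOT transported here (part L-b's `exists_memberEmbedding` supplies member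
embeddings in the quadratic files; not redone); the rank data of part L-c are degree-generic and apply verbatim. Strength of the open instances
unchanged; nothing minimal claimed; N104 untouched. EDGE LABELS: all theorems K (fact-free).
References: Deligne1982HodgeCycles (§4 p. 30 (disc φ), Lemma 4.6, Sublemma 4.7, proof of Thm. 4.8 (pp. 56–61): «S a connected smooth variety,
Y/S an abelian scheme with an action of E … disc is constant»); Landherr1936HermitianForms; vanGeemen1994HodgeAV (4.14, Lemma 5.2 (3));
VoisinHodgeI2002 (Thm. 9.3, §9.2.1); VoisinHodgeII2003 (§3.1.2); Lange2023AbelianVarietiesComplex (§1.7.2 Lemma 1.7.4).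
-/

noncomputable section

set_option linter.dupNamespace false

namespace Summit.HodgeConjecture.HodgeConjecture.Ring2.AbelianAll

open CategoryTheory AlgebraicGeometry Polynomial
open _root_.Topology _root_.Filter
open Literature.AlgebraicGeometry Literature.AlgebraicGeometry.Motives
open Literature.AlgebraicGeometry.HodgeTheory Literature.AlgebraicGeometry.VanGeemen1994 Literature.AlgebraicGeometry.Deligne1982
open Literature.AlgebraicTopology.SingularHomology (singularCohomology)
open Summit.HodgeConjecture.HodgeConjecture.Ring2.Hypotheses (RosatiCompatible)

/-! ## §1 AV level: Deligne's discriminant witness and the Rosati condition ride along an `η`-equivariant, `Q`-compatible transport -/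

section AVLevel

variable {A B : AbelianVariety ℂ} {η : A ⟶ A} {ψ : B ⟶ B} {R : Polynomial ℤ} [Fact (Irreducible (realPolyQ R))] {e₀ k dA : ℕ}
  {h : complexBetti A.X 2} {h' : complexBetti B.X 2}

/-- **Transport of `disc φ`.** `A`, `B` abelian varieties of the same dimension `d_A`; `T₁ : H¹(A(ℂ); ℂ) → H¹(B(ℂ); ℂ)` and
`T₂ : H^{2+2(d_A-1)}(A(ℂ); ℂ) → H^{2+2(d_A-1)}(B(ℂ); ℂ)` injective `ℂ`-linear maps carrying rational classes to rational classes, with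
`T₁ ∘ η^* = ψ^* ∘ T₁` and `T₂ (Q_{h, d_A-1}(x, y)) = Q_{h', d_A-1}(T₁ x, T₁ y)`. Then a discriminant witness of class `δ ∈ E⁺ˣ/N(Eˣ)` for
`(A, η, h)` (`HasWeilDiscriminantCM A η R e₀ k h δ`) is carried to one for `(B, ψ, h')`: the `E`-basis `x_b ↦ T₁ x_b` (the translates
`(ψ^*)ʲ T₁ x_b = T₁ (η^*)ʲ x_b` stay `ℂ`-independent), the top class `ω ↦ T₂ ω`, and the SAME rational pairing data `c_{abj}`, Gram matrix `Φ`
and unit `q` (Deligne p. 30: `disc φ` is an invariant of the `E`-hermitian space `(H₁(A, ℚ), φ)`). [cite: Deligne1982HodgeCycles, §4 p. 30 and Lemma 4.6]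
[cite: vanGeemen1994HodgeAV, Lemma 5.2 (3) and 4.14] -/
theorem hasWeilDiscriminantCM_of_transport (hAd : A.dim = dA) (hBd : B.dim = dA)
    (T₁ : complexBetti A.X 1 →ₗ[ℂ] complexBetti B.X 1)
    (T₂ : complexBetti A.X (2 + 2 * (dA - 1)) →ₗ[ℂ] complexBetti B.X (2 + 2 * (dA - 1)))
    (hT₁ : Function.Injective T₁) (hT₂ : Function.Injective T₂)
    (hr₁ : ∀ x, IsRationalClass x → IsRationalClass (T₁ x))
    (hr₂ : ∀ ω, IsRationalClass ω → IsRationalClass (T₂ ω))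
    (hTφ : ∀ x, T₁ (complexBetti.map η.hom.hom.hom 1 x) = complexBetti.map ψ.hom.hom.hom 1 (T₁ x))
    (hTQ : ∀ x y, T₂ (polarizationPairingOne A.X h (dA - 1) x y) = polarizationPairingOne B.X h' (dA - 1) (T₁ x) (T₁ y))
    {δ : cmNormResidueGroup R} (hs : HasWeilDiscriminantCM A η R e₀ k h δ) :
    HasWeilDiscriminantCM B ψ R e₀ k h' δ := by
  rw [hasWeilDiscriminantCM_iff, hAd] at hs
  rw [hasWeilDiscriminantCM_iff, hBd]
  obtain ⟨x, ω, c, Φ, q, hx, hind, hω, hω0, hQ, htr, hdet, hq⟩ := hs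
  -- `T₁` intertwines the powers of `η^*` and `ψ^*`
  have hTpow : ∀ (j : ℕ) (z : complexBetti A.X 1), T₁ ((pullbackOne A η ^ j) z) = (pullbackOne B ψ ^ j) (T₁ z) := by
    intro j
    induction j with
    | zero => intro z; simp only [pow_zero, Module.End.one_apply]
    | succ j ih =>
      intro z
      rw [pow_succ, pow_succ, Module.End.mul_apply, Module.End.mul_apply, ih]
      exact congrArg (pullbackOne B ψ ^ j) (hTφ z)
  refine ⟨fun i => T₁ (x i), T₂ ω, c, Φ, q, fun i => hr₁ _ (hx i), ?_, hr₂ _ hω, (map_ne_zero_iff T₂ hT₂).2 hω0,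
    fun a b j => ?_, htr, hdet, hq⟩
  · have hcomp : (fun p : Fin (2 * e₀) × Fin (2 * k) => (pullbackOne B ψ ^ (p.1 : ℕ)) (T₁ (x p.2))) =
        T₁ ∘ fun p : Fin (2 * e₀) × Fin (2 * k) => (pullbackOne A η ^ (p.1 : ℕ)) (x p.2) :=
      funext fun p => (hTpow p.1 (x p.2)).symm
    rw [hcomp]
    exact hind.map' T₁ (LinearMap.ker_eq_bot.2 hT₁)
  · rw [← hTpow, ← hTQ, hQ a b j, map_smul]

/-- The Rosati condition with the exponent `dim A - 1` renamed (`dim A = n`; definitional). [cite: Deligne1982HodgeCycles, §4 p. 33] -/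
theorem rosatiCompatible_iff_of_dim_eq {n : ℕ} (hAd : A.dim = n) :
    RosatiCompatible A η h ↔ ∀ x y : complexBetti A.X 1,
      polarizationPairingOne A.X h (n - 1) (pullbackOne A η x) y = -polarizationPairingOne A.X h (n - 1) x (pullbackOne A η y) := by
  subst hAd
  exact Iff.rfl

/-- **Transport of the Rosati condition** «the Rosati involution of `h` induces complex conjugation on `E`», `Q_h(η^* x, y) = -Q_h(x, η^* y)`
(`RosatiCompatible`): with `T₁` SURJECTIVE as well, `η`-equivariant and `Q`-compatible as above, it passes from `(A, η, h)` to `(B, ψ, h')`.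
[cite: Deligne1982HodgeCycles, §4 p. 33 and Milne 2003 re-edition endnote 16] -/
theorem rosatiCompatible_of_transport (hAd : A.dim = dA) (hBd : B.dim = dA)
    (T₁ : complexBetti A.X 1 →ₗ[ℂ] complexBetti B.X 1)
    (T₂ : complexBetti A.X (2 + 2 * (dA - 1)) →ₗ[ℂ] complexBetti B.X (2 + 2 * (dA - 1)))
    (hT₁ : Function.Surjective T₁)
    (hTφ : ∀ x, T₁ (complexBetti.map η.hom.hom.hom 1 x) = complexBetti.map ψ.hom.hom.hom 1 (T₁ x))
    (hTQ : ∀ x y, T₂ (polarizationPairingOne A.X h (dA - 1) x y) = polarizationPairingOne B.X h' (dA - 1) (T₁ x) (T₁ y))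
    (hros : RosatiCompatible A η h) : RosatiCompatible B ψ h' := by
  rw [rosatiCompatible_iff_of_dim_eq hAd] at hros
  rw [rosatiCompatible_iff_of_dim_eq hBd]
  intro x' y'
  obtain ⟨x, rfl⟩ := hT₁ x'
  obtain ⟨y, rfl⟩ := hT₁ y'
  have e1 : pullbackOne B ψ (T₁ x) = T₁ (pullbackOne A η x) := (hTφ x).symm
  have e2 : pullbackOne B ψ (T₁ y) = T₁ (pullbackOne A η y) := (hTφ y).symm
  rw [e1, e2, ← hTQ, ← hTQ, hros x y, map_neg]

end AVLevel

/-! ## §2 Along a family: through `Φ`-compatible charts, along paths, between any two members -/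

section Family

variable {𝒳 S : SchemeOver ℂ} {R : Polynomial ℤ} [Fact (Irreducible (realPolyQ R))] {e₀ k : ℕ}

/-- **Transport of `disc φ` along a path, through charts.** For `π : 𝒳 ⟶ S` homotopically locally trivial over `U ⊆ S(ℂ)`, an endomorphism `Φ`
of `𝒳` OVER `S` with fibre maps `Φ_u` (`Φ_u ≫ ι_u = ι_u ≫ Φ`), a global class `H ∈ H²(𝒳(ℂ); ℂ)`, a homotopy class of paths `γ` from `s` to `t`
in `U`, and charts `e_A : A ≅ X_s`, `e_B : B ≅ X_t` by abelian varieties of the same dimension `d_A` with endomorphisms `φ`, `ψ` matching `Φ_s`,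
`Φ_t`: a discriminant witness of class `δ` for `(A, φ, e_A^*(H|X_s))` yields one for `(B, ψ, e_B^*(H|X_t))` — §1 applied to
`T = e_B^* ∘ γ_* ∘ (e_A⁻¹)^*` in degrees `1` and `2 + 2(d_A-1)`: injective (`transportFun_injective`), rational
(`IsHomotopicallyLocallyTrivialOn.isRationalClass_transportFun`), `Φ`-equivariant (`transportFun_map_fiberHom`), `Q_H`-compatible (part L-a's
`transportFun_polarizationPairingOne`). [cite: Deligne1982HodgeCycles, §4 p. 30 and proof of Thm. 4.8 (pp. 56–61)] [cite: VoisinHodgeII2003, §3.1.2] -/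
theorem hasWeilDiscriminantCM_of_transportFun (π : 𝒳 ⟶ S) {U : Set (ComplexPoints S)}
    (hH : IsHomotopicallyLocallyTrivialOn π U) (Φ : 𝒳 ⟶ 𝒳) (hΦ : Φ ≫ π = π)
    (Φf : ∀ u : ComplexPoints S, fiberOver π u ⟶ fiberOver π u) (hΦf : ∀ u, Φf u ≫ fiberι π u = fiberι π u ≫ Φ)
    (H : complexBetti 𝒳 2) {s t : U} (γ : Path.Homotopic.Quotient s t)
    {A B : AbelianVariety ℂ} {dA : ℕ} (hAd : A.dim = dA) (hBd : B.dim = dA)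
    (eA : A.X ≅ fiberOver π s.1) (eB : B.X ≅ fiberOver π t.1) {φ : A ⟶ A} {ψ : B ⟶ B}
    (heA : eA.hom ≫ Φf s.1 = φ.hom.hom.hom ≫ eA.hom) (heB : eB.hom ≫ Φf t.1 = ψ.hom.hom.hom ≫ eB.hom)
    {δ : cmNormResidueGroup R}
    (hs : HasWeilDiscriminantCM A φ R e₀ k (complexBetti.map eA.hom 2 (complexBetti.map (fiberι π s.1) 2 H)) δ) :
    HasWeilDiscriminantCM B ψ R e₀ k (complexBetti.map eB.hom 2 (complexBetti.map (fiberι π t.1) 2 H)) δ := by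
  have hU : IsCohomologicallyLocallyTrivialOn π U := hH.isCohomologicallyLocallyTrivialOn
  have hinv : eA.inv ≫ φ.hom.hom.hom = Φf s.1 ≫ eA.inv := by
    rw [Iso.inv_comp_eq, ← Category.assoc, heA, Category.assoc, Iso.hom_inv_id, Category.comp_id]
  have h1 : ∀ z, complexBetti.map eA.inv 1 (complexBetti.map φ.hom.hom.hom 1 z) =
      complexBetti.map (Φf s.1) 1 (complexBetti.map eA.inv 1 z) := fun z => by
    have hc := congrArg (fun F => complexBetti.map F 1 z) hinv
    simpa only [complexBetti.map_comp, ModuleCat.comp_apply] using hc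
  have h2 : ∀ y, complexBetti.map eB.hom 1 (complexBetti.map (Φf t.1) 1 y) =
      complexBetti.map ψ.hom.hom.hom 1 (complexBetti.map eB.hom 1 y) := fun y => by
    have hc := congrArg (fun F => complexBetti.map F 1 y) heB
    simpa only [complexBetti.map_comp, ModuleCat.comp_apply] using hc
  refine hasWeilDiscriminantCM_of_transport hAd hBd
    ((complexBetti.map eB.hom 1).hom ∘ₗ transportLinear π 1 hU γ ∘ₗ (complexBetti.map eA.inv 1).hom)
    ((complexBetti.map eB.hom (2 + 2 * (dA - 1))).hom ∘ₗ transportLinear π (2 + 2 * (dA - 1)) hU γ ∘ₗ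
      (complexBetti.map eA.inv (2 + 2 * (dA - 1))).hom)
    ?_ ?_ ?_ ?_ ?_ ?_ hs
  · intro z z' hzz'
    simp only [LinearMap.comp_apply, transportLinear_apply] at hzz'
    exact (complexBetti.bijective_map_of_iso eA.symm 1).1
      (transportFun_injective π 1 hU γ ((complexBetti.bijective_map_of_iso eB 1).1 hzz'))
  · intro z z' hzz'
    simp only [LinearMap.comp_apply, transportLinear_apply] at hzz'
    exact (complexBetti.bijective_map_of_iso eA.symm _).1
      (transportFun_injective π _ hU γ ((complexBetti.bijective_map_of_iso eB _).1 hzz'))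
  · intro z hz
    simp only [LinearMap.comp_apply, transportLinear_apply]
    exact IsRationalClass.pullback _ (hH.isRationalClass_transportFun π 1 γ (IsRationalClass.pullback _ hz))
  · intro z hz
    simp only [LinearMap.comp_apply, transportLinear_apply]
    exact IsRationalClass.pullback _ (hH.isRationalClass_transportFun π _ γ (IsRationalClass.pullback _ hz))
  · intro z
    simp only [LinearMap.comp_apply, transportLinear_apply]
    rw [h1, transportFun_map_fiberHom π 1 hU Φ hΦ Φf hΦf γ, h2]
  · intro z w
    simp only [LinearMap.comp_apply, transportLinear_apply]
    rw [map_polarizationPairingOne eA.inv, eA.complexBetti_map_inv_map_hom, transportFun_polarizationPairingOne π hU H γ,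
      map_polarizationPairingOne eB.hom]

/-- **Transport of the Rosati condition along a path, through charts** (the same `T`; it is surjective because transport along `γ` is undone by
transport along `γ⁻¹`). [cite: Deligne1982HodgeCycles, §4 p. 33 and proof of Thm. 4.8 (pp. 56–61)] [cite: VoisinHodgeI2002, §9.2.1] -/
theorem rosatiCompatible_of_transportFun (π : 𝒳 ⟶ S) {U : Set (ComplexPoints S)}
    (hU : IsCohomologicallyLocallyTrivialOn π U) (Φ : 𝒳 ⟶ 𝒳) (hΦ : Φ ≫ π = π)
    (Φf : ∀ u : ComplexPoints S, fiberOver π u ⟶ fiberOver π u) (hΦf : ∀ u, Φf u ≫ fiberι π u = fiberι π u ≫ Φ)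
    (H : complexBetti 𝒳 2) {s t : U} (γ : Path.Homotopic.Quotient s t)
    {A B : AbelianVariety ℂ} {dA : ℕ} (hAd : A.dim = dA) (hBd : B.dim = dA)
    (eA : A.X ≅ fiberOver π s.1) (eB : B.X ≅ fiberOver π t.1) {φ : A ⟶ A} {ψ : B ⟶ B}
    (heA : eA.hom ≫ Φf s.1 = φ.hom.hom.hom ≫ eA.hom) (heB : eB.hom ≫ Φf t.1 = ψ.hom.hom.hom ≫ eB.hom)
    (hs : RosatiCompatible A φ (complexBetti.map eA.hom 2 (complexBetti.map (fiberι π s.1) 2 H))) :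
    RosatiCompatible B ψ (complexBetti.map eB.hom 2 (complexBetti.map (fiberι π t.1) 2 H)) := by
  have hinv : eA.inv ≫ φ.hom.hom.hom = Φf s.1 ≫ eA.inv := by
    rw [Iso.inv_comp_eq, ← Category.assoc, heA, Category.assoc, Iso.hom_inv_id, Category.comp_id]
  have h1 : ∀ z, complexBetti.map eA.inv 1 (complexBetti.map φ.hom.hom.hom 1 z) =
      complexBetti.map (Φf s.1) 1 (complexBetti.map eA.inv 1 z) := fun z => by
    have hc := congrArg (fun F => complexBetti.map F 1 z) hinv
    simpa only [complexBetti.map_comp, ModuleCat.comp_apply] using hc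
  have h2 : ∀ y, complexBetti.map eB.hom 1 (complexBetti.map (Φf t.1) 1 y) =
      complexBetti.map ψ.hom.hom.hom 1 (complexBetti.map eB.hom 1 y) := fun y => by
    have hc := congrArg (fun F => complexBetti.map F 1 y) heB
    simpa only [complexBetti.map_comp, ModuleCat.comp_apply] using hc
  refine rosatiCompatible_of_transport hAd hBd
    ((complexBetti.map eB.hom 1).hom ∘ₗ transportLinear π 1 hU γ ∘ₗ (complexBetti.map eA.inv 1).hom)
    ((complexBetti.map eB.hom (2 + 2 * (dA - 1))).hom ∘ₗ transportLinear π (2 + 2 * (dA - 1)) hU γ ∘ₗ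
      (complexBetti.map eA.inv (2 + 2 * (dA - 1))).hom)
    ?_ ?_ ?_ hs
  · intro z
    refine ⟨complexBetti.map eA.hom 1 (transportFun π 1 hU γ.symm (complexBetti.map eB.inv 1 z)), ?_⟩
    simp only [LinearMap.comp_apply, transportLinear_apply]
    rw [eA.complexBetti_map_inv_map_hom, ← transportFun_trans, Path.Homotopic.Quotient.symm_trans, transportFun_refl,
      eB.complexBetti_map_hom_map_inv]
  · intro z
    simp only [LinearMap.comp_apply, transportLinear_apply]
    rw [h1, transportFun_map_fiberHom π 1 hU Φ hΦ Φf hΦf γ, h2]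
  · intro z w
    simp only [LinearMap.comp_apply, transportLinear_apply]
    rw [map_polarizationPairingOne eA.inv, eA.complexBetti_map_inv_map_hom, transportFun_polarizationPairingOne π hU H γ,
      map_polarizationPairingOne eB.hom]

/-- **`disc φ` IS CONSTANT ALONG A SMOOTH PROPER FAMILY WITH AN `E`-ACTION.** `π : 𝒳 ⟶ S` proper and smooth over a separated compact base,
smooth and of finite type over `ℂ` with `S(ℂ)` connected; `Φ : 𝒳 ⟶ 𝒳` over `S`; `H` a global class in `H²(𝒳(ℂ); ℂ)`; for every `s` a chart
`e_s : A_s ≅ X_s` by an abelian variety of dimension `d'` with an endomorphism `φ_s` matching the fibre map of `Φ`. If `(A_s, φ_s, e_s^*(H|X_s))`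
has a discriminant witness of class `δ ∈ E⁺ˣ/N(Eˣ)` for ONE `s`, then so has `(A_t, φ_t, e_t^*(H|X_t))` for EVERY `t` (path-connectedness of
`S(ℂ)`; Ehresmann on complex points; the previous theorem). In print: «`Y/S` an abelian scheme with an action of `E` … `disc` is locally constant»
(Deligne, proof of Thm. 4.8). [cite: Deligne1982HodgeCycles, §4 p. 30 and proof of Thm. 4.8 (pp. 56–61)] [cite: VoisinHodgeI2002, Thm. 9.3 and §9.2.1] -/
theorem hasWeilDiscriminantCM_of_fibreTransport (π : 𝒳 ⟶ S) (d m : ℕ)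
    [SmoothOfRelativeDimension d π.left] [IsProper π.left] [SmoothOfRelativeDimension m S.hom]
    [LocallyOfFiniteType S.hom] [IsSeparated S.hom] [CompactSpace S.left] [ConnectedSpace (ComplexPoints S)]
    (Φ : 𝒳 ⟶ 𝒳) (hΦ : Φ ≫ π = π) (H : complexBetti 𝒳 2)
    (A : ComplexPoints S → AbelianVariety ℂ) (e : ∀ s, (A s).X ≅ fiberOver π s) (φ : ∀ s, A s ⟶ A s)
    (hK : ∀ s, ∃ Φs : fiberOver π s ⟶ fiberOver π s, Φs ≫ fiberι π s = fiberι π s ≫ Φ ∧ (e s).hom ≫ Φs = (φ s).hom.hom.hom ≫ (e s).hom)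
    {d' : ℕ} (hdim : ∀ s, (A s).dim = d') {δ : cmNormResidueGroup R} (s t : ComplexPoints S)
    (hs : HasWeilDiscriminantCM (A s) (φ s) R e₀ k (complexBetti.map (e s).hom 2 (complexBetti.map (fiberι π s) 2 H)) δ) :
    HasWeilDiscriminantCM (A t) (φ t) R e₀ k (complexBetti.map (e t).hom 2 (complexBetti.map (fiberι π t) 2 H)) δ := by
  choose Φf hΦf he using hK
  haveI := pathConnectedSpace_complexPoints_of_smoothOfRelativeDimension S m
  have hcont : Continuous fun x : ComplexPoints S => (⟨x, Set.mem_univ x⟩ : (Set.univ : Set (ComplexPoints S))) :=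
    continuous_id.subtype_mk _
  exact hasWeilDiscriminantCM_of_transportFun π (isHomotopicallyLocallyTrivialOn_univ π d m) Φ hΦ Φf hΦf H
    (s := ⟨s, Set.mem_univ s⟩) (t := ⟨t, Set.mem_univ t⟩) ⟦(PathConnectedSpace.somePath s t).map hcont⟧ (hdim s) (hdim t)
    (e s) (e t) (he s) (he t) hs

/-- **The Rosati condition is constant along a smooth proper family with an `E`-action** (same setting; `rosatiCompatible_of_transportFun`).
[cite: Deligne1982HodgeCycles, §4 p. 33 and proof of Thm. 4.8 (pp. 56–61)] [cite: VoisinHodgeI2002, Thm. 9.3 and §9.2.1] -/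
theorem rosatiCompatible_of_fibreTransport (π : 𝒳 ⟶ S) (d m : ℕ)
    [SmoothOfRelativeDimension d π.left] [IsProper π.left] [SmoothOfRelativeDimension m S.hom]
    [LocallyOfFiniteType S.hom] [IsSeparated S.hom] [CompactSpace S.left] [ConnectedSpace (ComplexPoints S)]
    (Φ : 𝒳 ⟶ 𝒳) (hΦ : Φ ≫ π = π) (H : complexBetti 𝒳 2)
    (A : ComplexPoints S → AbelianVariety ℂ) (e : ∀ s, (A s).X ≅ fiberOver π s) (φ : ∀ s, A s ⟶ A s)
    (hK : ∀ s, ∃ Φs : fiberOver π s ⟶ fiberOver π s, Φs ≫ fiberι π s = fiberι π s ≫ Φ ∧ (e s).hom ≫ Φs = (φ s).hom.hom.hom ≫ (e s).hom)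
    {d' : ℕ} (hdim : ∀ s, (A s).dim = d') (s t : ComplexPoints S)
    (hs : RosatiCompatible (A s) (φ s) (complexBetti.map (e s).hom 2 (complexBetti.map (fiberι π s) 2 H))) :
    RosatiCompatible (A t) (φ t) (complexBetti.map (e t).hom 2 (complexBetti.map (fiberι π t) 2 H)) := by
  choose Φf hΦf he using hK
  haveI := pathConnectedSpace_complexPoints_of_smoothOfRelativeDimension S m
  have hcont : Continuous fun x : ComplexPoints S => (⟨x, Set.mem_univ x⟩ : (Set.univ : Set (ComplexPoints S))) :=
    continuous_id.subtype_mk _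
  exact rosatiCompatible_of_transportFun π (isHomotopicallyLocallyTrivialOn_univ π d m).isCohomologicallyLocallyTrivialOn Φ hΦ Φf hΦf H
    (s := ⟨s, Set.mem_univ s⟩) (t := ⟨t, Set.mem_univ t⟩) ⟦(PathConnectedSpace.somePath s t).map hcont⟧ (hdim s) (hdim t)
    (e s) (e t) (he s) (he t) hs

/-- **THE `δ`-COMPONENT IS THE SAME FOR ALL MEMBERS OF A COMPACT ABELIAN PENCIL WITH AN `E`-ACTION** (`IsCompactAbelianPencil f d`: smooth
projective family of `d`-folds over a smooth projective curve): with a global endomorphism `Φ` over `S`, a global class `H` and `Φ`-compatible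
charts `(A_s, e_s, φ_s)`, for any two members `s`, `t`: `(A_s, φ_s, e_s^*(H|X_s))` has a discriminant witness of class `δ ∈ E⁺ˣ/N(Eˣ)` iff
`(A_t, φ_t, e_t^*(H|X_t))` has one. The member hypothesis `HasWeilDiscriminantCM … δ` of the cell's `WeilClassesComponentCM R e₀ k δ` (and of
part S-b's anchors) is read at ONE member. [cite: Deligne1982HodgeCycles, §4 p. 30 and proof of Thm. 4.8 (pp. 56–61)] [cite: Landherr1936HermitianForms]
[cite: VoisinHodgeI2002, Thm. 9.3 and §9.2.1] -/
theorem hasWeilDiscriminantCM_member_iff {f : 𝒳 ⟶ S} {d : ℕ} (hf : IsCompactAbelianPencil f d)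
    (Φ : 𝒳 ⟶ 𝒳) (hΦ : Φ ≫ f = f) (H : complexBetti 𝒳 2)
    (A : ComplexPoints S → AbelianVariety ℂ) (e : ∀ s, (A s).X ≅ fiberOver f s) (φ : ∀ s, A s ⟶ A s)
    (hK : ∀ s, ∃ Φs : fiberOver f s ⟶ fiberOver f s, Φs ≫ fiberι f s = fiberι f s ≫ Φ ∧ (e s).hom ≫ Φs = (φ s).hom.hom.hom ≫ (e s).hom)
    (δ : cmNormResidueGroup R) (s t : ComplexPoints S) :
    HasWeilDiscriminantCM (A s) (φ s) R e₀ k (complexBetti.map (e s).hom 2 (complexBetti.map (fiberι f s) 2 H)) δ ↔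
      HasWeilDiscriminantCM (A t) (φ t) R e₀ k (complexBetti.map (e t).hom 2 (complexBetti.map (fiberι f t) 2 H)) δ := by
  haveI : IsProper S.hom := IsSmoothProjective.isProper_holds hf.isSmoothProjective_base
  haveI : CompactSpace S.left := QuasiCompact.compactSpace_of_compactSpace S.hom
  haveI := hf.isSmoothProjective_base.smoothOfRelativeDimension
  haveI : IsProper f.left := hf.isSmoothProjectiveFamily.isProper
  haveI := hf.isSmoothProjectiveFamily.smoothOfRelativeDimension
  haveI := connectedSpace_complexPoints hf.isSmoothProjective_base
  have hdim : ∀ u, (A u).dim = d := fun u => Andre1996.compactPencil_dim_eq_of_iso hf (e u)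
  exact ⟨hasWeilDiscriminantCM_of_fibreTransport f d 1 Φ hΦ H A e φ hK hdim s t,
    hasWeilDiscriminantCM_of_fibreTransport f d 1 Φ hΦ H A e φ hK hdim t s⟩

/-- **The Rosati condition is the same for all members of a compact abelian pencil with an `E`-action** (same setting): `(A_s, φ_s, e_s^*(H|X_s))`
is Rosati-compatible iff `(A_t, φ_t, e_t^*(H|X_t))` is. [cite: Deligne1982HodgeCycles, §4 p. 33 and proof of Thm. 4.8 (pp. 56–61)]
[cite: VoisinHodgeI2002, Thm. 9.3 and §9.2.1] -/
theorem rosatiCompatible_member_iff {f : 𝒳 ⟶ S} {d : ℕ} (hf : IsCompactAbelianPencil f d)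
    (Φ : 𝒳 ⟶ 𝒳) (hΦ : Φ ≫ f = f) (H : complexBetti 𝒳 2)
    (A : ComplexPoints S → AbelianVariety ℂ) (e : ∀ s, (A s).X ≅ fiberOver f s) (φ : ∀ s, A s ⟶ A s)
    (hK : ∀ s, ∃ Φs : fiberOver f s ⟶ fiberOver f s, Φs ≫ fiberι f s = fiberι f s ≫ Φ ∧ (e s).hom ≫ Φs = (φ s).hom.hom.hom ≫ (e s).hom)
    (s t : ComplexPoints S) :
    RosatiCompatible (A s) (φ s) (complexBetti.map (e s).hom 2 (complexBetti.map (fiberι f s) 2 H)) ↔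
      RosatiCompatible (A t) (φ t) (complexBetti.map (e t).hom 2 (complexBetti.map (fiberι f t) 2 H)) := by
  haveI : IsProper S.hom := IsSmoothProjective.isProper_holds hf.isSmoothProjective_base
  haveI : CompactSpace S.left := QuasiCompact.compactSpace_of_compactSpace S.hom
  haveI := hf.isSmoothProjective_base.smoothOfRelativeDimension
  haveI : IsProper f.left := hf.isSmoothProjectiveFamily.isProper
  haveI := hf.isSmoothProjectiveFamily.smoothOfRelativeDimension
  haveI := connectedSpace_complexPoints hf.isSmoothProjective_base
  have hdim : ∀ u, (A u).dim = d := fun u => Andre1996.compactPencil_dim_eq_of_iso hf (e u)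
  exact ⟨rosatiCompatible_of_fibreTransport f d 1 Φ hΦ H A e φ hK hdim s t,
    rosatiCompatible_of_fibreTransport f d 1 Φ hΦ H A e φ hK hdim t s⟩

end Family

end Summit.HodgeConjecture.HodgeConjecture.Ring2.AbelianAll

end
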